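import Literature.Analysis.FunctionSpaces.PolchinskiHeatEquation
import Mathlib.Analysis.Calculus.ParametricIntegral
import Mathlib.Analysis.SpecialFunctions.Log.Deriv
import Mathlib.Analysis.Calculus.Deriv.Inv
import HarnessLib

/-!
# The Polchinski equation `∂_t V_t = ½ Δ_{Ċ_t} V_t − ½ (∇V_t)²_{Ċ_t}` for the renormalised potential
# (Bauerschmidt–Bodineau–Dagallier, Proposition 7)

Topic `Literature/Analysis/FunctionSpaces`; third "proof architecture" file behind the named fact
`Polchinski.BauerschmidtBodineau_multiscaleBakryEmery` ([BBD] Theorem 3, `MultiscaleBakryEmery.lean`),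
after `PolchinskiSemigroup.lean` (§3.2 algebra: Props 6, 8) and `PolchinskiHeatEquation.lean` (§3.1
Prop 5).  Here: [BBD] **Proposition 7** (the Polchinski equation, a Hamilton–Jacobi–Bellman equation
for the renormalised potential `V_t(φ) = −log E_{C_t}[e^{−V₀(φ+ζ)}]`, p0014 L46–70): «let `V₀ ∈ C²`.
Then for every `t` such that `C_t` is differentiable, `∂_t V_t = ½ Δ_{Ċ_t} V_t − ½ (∇V_t)²_{Ċ_t}`»,
with the printed proof: `Z_t = E_{C_t}[e^{−V₀(φ+ζ)}]` solves the heat equation `∂_t Z_t = ½Δ_{Ċ_t}Z_t`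
(Prop 5), and `V_t = −log Z_t` gives `∂_t V_t = −∂_tZ_t/Z_t = −½ e^{V_t}Δ_{Ċ_t}e^{−V_t}
= ½Δ_{Ċ_t}V_t − ½(∇V_t)²_{Ċ_t}`.  Same statement: BB21 Proposition 1 (`paper:arxiv-1907.12308` p0008,
proof p0010 L70–85).

## Main results (sorry-free; no new definitions, no new named facts)

* `hasFDerivAt_integral_shift` — differentiation under a probability average for bounded `G` with
  bounded continuous Fréchet derivative: `D(φ ↦ E[G(φ+ζ)]) = E[DG(φ+ζ)]` (dominated differentiation).
* `hasFDerivAt_integral_exp_neg`, `hasFDerivAt_integral_fderiv_exp_neg` — `∇Z_t = E_{C_t}[∇e^{−V₀}(φ+ζ)]`,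
  `Hess Z_t = E_{C_t}[D²e^{−V₀}(φ+ζ)]`.
* `hasFDerivAt_renormPotential` — `V_t` is differentiable in `φ` with `∇V_t = −∇Z_t/Z_t`
  (`= P_{0,t}(∇V₀)`, [BBD] Lemma 2 (e:PtdV)); `hasFDerivAt_fderiv_renormPotential` — the Hessian
  `Hess V_t = −Hess Z_t/Z_t + ∇Z_t ⊗ ∇Z_t/Z_t²` as a continuous bilinear map ((e:PtHessV)).
* `hasDerivAt_renormPotential_heat` — `∂_t V_t(φ) = −½ Σ_{ij} Ċ_t^{ij} E_{C_t}[∂_i∂_j e^{−V₀}(φ+ζ)] / Z_t(φ)`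
  for `t > 0` (Prop 5 + chain rule).
* **`hasDerivAt_renormPotential`** — **[BBD] Proposition 7**: for `t > 0`,
  `∂_t V_t(φ) = ½ Σ_{ij} Ċ_t^{ij} Hess V_t(φ)(e_i,e_j) − ½ Σ_{ij} Ċ_t^{ij} ∂_iV_t(φ) ∂_jV_t(φ)`, the
  derivatives of `V_t` being the certified ones above.

Setting and hypotheses: `D : Polchinski.CovDecomposition N` (possibly DEGENERATE positive semidefinite
`Ċ_t`; `X = ℝ^N`); `V₀` bounded below with `e^{−V₀}` twice Fréchet differentiable, `∇e^{−V₀}` bounded,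
`D²e^{−V₀}` bounded and uniformly continuous (these hold when `V₀ ∈ C²` is bounded below with bounded,
uniformly continuous first and second derivatives — the printed «`V₀ ∈ C²`» plus boundedness).
-- TODO(general form): `V₀ ∈ C²` of polynomial growth; the right derivative at `t = 0`.
What is NOT here: the generator identities of Prop 8 (`∂_t P_{s,t}F = L_t P_{s,t}F`,
`−∂_t E_{ν_t} = E_{ν_t}L_t`), Lemma 1 and Theorem 3.  Nothing here concerns Yang–Mills.

## References

* [BauerschmidtBodineauDagallier2023] R. Bauerschmidt, T. Bodineau, B. Dagallier, Probab. Surveys 21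
  (2024) 200–290, arXiv:2307.07619 — Proposition 7 p0014 L46–70 (and Lemma 2 p0017). READ (held).
* [BauerschmidtBodineau2021SineGordonLSI] R. Bauerschmidt, T. Bodineau, CPAM 74 (2021), Prop 1,
  §2.4. READ (held).
-/

noncomputable section

open MeasureTheory ProbabilityTheory Filter Topology Set
open scoped RealInnerProductSpace Matrix MatrixOrder

namespace Literature.Analysis.FunctionSpaces

namespace Polchinski

variable {N : ℕ}

/-! ### Differentiation under a Gaussian (or any probability) average -/

section UnderIntegral

variable {F : Type*} [NormedAddCommGroup F] [NormedSpace ℝ F] [SecondCountableTopology F]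

/-- **Differentiation under the average**: if `G : ℝ^N → F` is bounded with a bounded continuous
Fréchet derivative `D1`, then for every probability measure `P` on `ℝ^N` the shifted average
`φ ↦ ∫ G(φ + ζ) dP(ζ)` has Fréchet derivative `∫ D1(φ + ζ) dP(ζ)` (dominated differentiation; the
«direct computation» behind [BBD]'s spatial derivatives of `P_{C_t} ∗ F`, Prop 5 / Lemma 2).
[cite: BauerschmidtBodineauDagallier2023, Proposition 5 (proof)] -/
theorem hasFDerivAt_integral_shift {G : EuclideanSpace ℝ (Fin N) → F}
    {D1 : EuclideanSpace ℝ (Fin N) → EuclideanSpace ℝ (Fin N) →L[ℝ] F}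
    (h1 : ∀ x, HasFDerivAt G (D1 x) x) (hD1c : Continuous D1)
    {K0 : ℝ} (hG : ∀ x, ‖G x‖ ≤ K0) {K1 : ℝ} (hD1 : ∀ x, ‖D1 x‖ ≤ K1)
    (P : Measure (EuclideanSpace ℝ (Fin N))) [IsProbabilityMeasure P] (φ : EuclideanSpace ℝ (Fin N)) :
    HasFDerivAt (fun ψ => ∫ ζ, G (ψ + ζ) ∂P) (∫ ζ, D1 (φ + ζ) ∂P) φ := by
  have hGc : Continuous G := continuous_iff_continuousAt.2 fun x => (h1 x).continuousAt
  refine hasFDerivAt_integral_of_dominated_of_fderiv_le (𝕜 := ℝ) (μ := P) (s := univ)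
    (F := fun ψ ζ => G (ψ + ζ)) (F' := fun ψ ζ => D1 (ψ + ζ)) (bound := fun _ => K1) (x₀ := φ)
    univ_mem ?_ ?_ ?_ ?_ (integrable_const K1) ?_
  · exact Eventually.of_forall fun ψ =>
      (hGc.comp (continuous_const.add continuous_id)).aestronglyMeasurable
  · exact Integrable.of_bound (hGc.comp (continuous_const.add continuous_id)).aestronglyMeasurable K0
      (Eventually.of_forall fun ζ => hG (φ + ζ))
  · exact (hD1c.comp (continuous_const.add continuous_id)).aestronglyMeasurable
  · exact Eventually.of_forall fun ζ ψ _ => hD1 (ψ + ζ)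
  · refine Eventually.of_forall fun ζ ψ _ => ?_
    have h := (h1 (ψ + ζ)).comp ψ ((hasFDerivAt_id ψ).add_const ζ)
    rw [ContinuousLinearMap.comp_id] at h
    exact h

end UnderIntegral

/-! ### The renormalised potential is `C²` in `φ` and solves the Polchinski equation in `t` -/

section PolchinskiEq

variable (D : CovDecomposition N) {V₀ : EuclideanSpace ℝ (Fin N) → ℝ}
  {D1 : EuclideanSpace ℝ (Fin N) → EuclideanSpace ℝ (Fin N) →L[ℝ] ℝ}
  {D2 : EuclideanSpace ℝ (Fin N) → EuclideanSpace ℝ (Fin N) →L[ℝ] EuclideanSpace ℝ (Fin N) →L[ℝ] ℝ}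

/-- `V₀ = −log e^{−V₀}` is measurable as soon as `e^{−V₀}` is differentiable. [folklore] -/
private theorem measurable_of_hasFDerivAt_exp_neg
    (hG1 : ∀ x, HasFDerivAt (fun x => Real.exp (-V₀ x)) (D1 x) x) : Measurable V₀ := by
  have hc : Continuous fun x => Real.exp (-V₀ x) :=
    continuous_iff_continuousAt.2 fun x => (hG1 x).continuousAt
  have he : V₀ = fun x => -Real.log (Real.exp (-V₀ x)) := by
    funext x; rw [Real.log_exp, neg_neg]
  rw [he]
  exact (Real.measurable_log.comp hc.measurable).neg

/-- `|e^{−V₀ x}| ≤ e^{−b}` (as a norm bound) when `b ≤ V₀`. [folklore] -/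
private theorem norm_exp_neg_le {b : ℝ} (hb : ∀ φ, b ≤ V₀ φ) (x : EuclideanSpace ℝ (Fin N)) :
    ‖Real.exp (-V₀ x)‖ ≤ Real.exp (-b) := by
  rw [Real.norm_eq_abs, abs_of_pos (Real.exp_pos _)]
  exact Real.exp_le_exp.2 (neg_le_neg (hb x))

/-- **`Z_t(φ) = E_{C_t}[e^{−V₀(φ+ζ)}]` is differentiable in `φ` with `∇Z_t(φ) = E_{C_t}[∇e^{−V₀}(φ+ζ)]`**
(differentiation under the Gaussian average; [BBD] proof of Lemma 2 / (e:PtdV) at `s = 0`).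
[cite: BauerschmidtBodineauDagallier2023, Lemma 2 (proof)] -/
theorem hasFDerivAt_integral_exp_neg
    (hG1 : ∀ x, HasFDerivAt (fun x => Real.exp (-V₀ x)) (D1 x) x)
    (hG2 : ∀ x, HasFDerivAt D1 (D2 x) x) {b : ℝ} (hb : ∀ φ, b ≤ V₀ φ)
    {K1 : ℝ} (hK1 : ∀ x, ‖D1 x‖ ≤ K1) (t : ℝ) (φ : EuclideanSpace ℝ (Fin N)) :
    HasFDerivAt (fun ψ => ∫ ζ, Real.exp (-V₀ (ψ + ζ)) ∂(multivariateGaussian 0 (D.C t)))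
      (∫ ζ, D1 (φ + ζ) ∂(multivariateGaussian 0 (D.C t))) φ :=
  hasFDerivAt_integral_shift hG1 (continuous_iff_continuousAt.2 fun x => (hG2 x).continuousAt)
    (norm_exp_neg_le hb) hK1 _ φ

/-- **Second derivative**: `∇Z_t` is differentiable with `Hess Z_t(φ) = E_{C_t}[D²e^{−V₀}(φ+ζ)]`.
[cite: BauerschmidtBodineauDagallier2023, Lemma 2 (proof)] -/
theorem hasFDerivAt_integral_fderiv_exp_neg
    (hG2 : ∀ x, HasFDerivAt D1 (D2 x) x) {K1 : ℝ} (hK1 : ∀ x, ‖D1 x‖ ≤ K1)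
    {M : ℝ} (hM : ∀ x, ‖D2 x‖ ≤ M) (hD2c : Continuous D2) (t : ℝ) (φ : EuclideanSpace ℝ (Fin N)) :
    HasFDerivAt (fun ψ => ∫ ζ, D1 (ψ + ζ) ∂(multivariateGaussian 0 (D.C t)))
      (∫ ζ, D2 (φ + ζ) ∂(multivariateGaussian 0 (D.C t))) φ :=
  hasFDerivAt_integral_shift hG2 hD2c hK1 hM _ φ

/-- **The renormalised potential is differentiable in `φ`**:
`∇V_t(φ) = −E_{C_t}[∇e^{−V₀}(φ+ζ)] / E_{C_t}[e^{−V₀(φ+ζ)}]` — i.e. `∇V_t = P_{0,t}(∇V₀)`, [BBD] (e:PtdV),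
since `∇e^{−V₀} = −e^{−V₀}∇V₀`. [cite: BauerschmidtBodineauDagallier2023, Lemma 2 (e:PtdV)] -/
theorem hasFDerivAt_renormPotential
    (hG1 : ∀ x, HasFDerivAt (fun x => Real.exp (-V₀ x)) (D1 x) x)
    (hG2 : ∀ x, HasFDerivAt D1 (D2 x) x) {b : ℝ} (hb : ∀ φ, b ≤ V₀ φ)
    {K1 : ℝ} (hK1 : ∀ x, ‖D1 x‖ ≤ K1) (t : ℝ) (φ : EuclideanSpace ℝ (Fin N)) :
    HasFDerivAt (renormPotential D V₀ t)
      (-((∫ ζ, Real.exp (-V₀ (φ + ζ)) ∂(multivariateGaussian 0 (D.C t)))⁻¹ •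
        ∫ ζ, D1 (φ + ζ) ∂(multivariateGaussian 0 (D.C t)))) φ := by
  have hV : Measurable V₀ := measurable_of_hasFDerivAt_exp_neg hG1
  have hZ := hasFDerivAt_integral_exp_neg D hG1 hG2 hb hK1 t φ
  have hne : (∫ ζ, Real.exp (-V₀ (φ + ζ)) ∂(multivariateGaussian 0 (D.C t))) ≠ 0 :=
    (integral_exp_neg_pos hV hb _ φ).ne'
  have h := (hZ.log hne).neg
  exact h

/-- **The renormalised potential is twice differentiable in `φ`**, with the Hessian of `−log Z_t`:
`Hess V_t = −Z_t⁻¹ Hess Z_t + Z_t⁻² ∇Z_t ⊗ ∇Z_t` (as a continuous bilinear map), where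
`∇Z_t = E_{C_t}[∇e^{−V₀}(φ+ζ)]`, `Hess Z_t = E_{C_t}[D²e^{−V₀}(φ+ζ)]` ([BBD] Lemma 2 (e:PtHessV)
/ Lemma 3: the Hessian of `V_t` as a fluctuation-measure variance).
[cite: BauerschmidtBodineauDagallier2023, Lemma 2 (e:PtHessV)] -/
theorem hasFDerivAt_fderiv_renormPotential
    (hG1 : ∀ x, HasFDerivAt (fun x => Real.exp (-V₀ x)) (D1 x) x)
    (hG2 : ∀ x, HasFDerivAt D1 (D2 x) x) {b : ℝ} (hb : ∀ φ, b ≤ V₀ φ)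
    {K1 : ℝ} (hK1 : ∀ x, ‖D1 x‖ ≤ K1) {M : ℝ} (hM : ∀ x, ‖D2 x‖ ≤ M) (hD2c : Continuous D2)
    (t : ℝ) (φ : EuclideanSpace ℝ (Fin N)) :
    HasFDerivAt (fun ψ => -((∫ ζ, Real.exp (-V₀ (ψ + ζ)) ∂(multivariateGaussian 0 (D.C t)))⁻¹ •
        ∫ ζ, D1 (ψ + ζ) ∂(multivariateGaussian 0 (D.C t))))
      (-((∫ ζ, Real.exp (-V₀ (φ + ζ)) ∂(multivariateGaussian 0 (D.C t)))⁻¹ •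
          (∫ ζ, D2 (φ + ζ) ∂(multivariateGaussian 0 (D.C t))) +
        ((-((∫ ζ, Real.exp (-V₀ (φ + ζ)) ∂(multivariateGaussian 0 (D.C t))) ^ 2)⁻¹) •
          ∫ ζ, D1 (φ + ζ) ∂(multivariateGaussian 0 (D.C t))).smulRight
          (∫ ζ, D1 (φ + ζ) ∂(multivariateGaussian 0 (D.C t))))) φ := by
  have hV : Measurable V₀ := measurable_of_hasFDerivAt_exp_neg hG1
  have hZ := hasFDerivAt_integral_exp_neg D hG1 hG2 hb hK1 t φ
  have hne : (∫ ζ, Real.exp (-V₀ (φ + ζ)) ∂(multivariateGaussian 0 (D.C t))) ≠ 0 :=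
    (integral_exp_neg_pos hV hb _ φ).ne'
  have hinv : HasFDerivAt
      (fun ψ => (∫ ζ, Real.exp (-V₀ (ψ + ζ)) ∂(multivariateGaussian 0 (D.C t)))⁻¹)
      ((-((∫ ζ, Real.exp (-V₀ (φ + ζ)) ∂(multivariateGaussian 0 (D.C t))) ^ 2)⁻¹) •
        ∫ ζ, D1 (φ + ζ) ∂(multivariateGaussian 0 (D.C t))) φ :=
    (hasDerivAt_inv hne).comp_hasFDerivAt φ hZ
  have hH := hasFDerivAt_integral_fderiv_exp_neg D hG2 hK1 hM hD2c t φ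
  exact (hinv.fun_smul hH).fun_neg

/-- **Time derivative of the renormalised potential (heat form)**: for `t > 0`,
`∂_t V_t(φ) = −(∂_t Z_t(φ))/Z_t(φ) = −½ Σ_{ij} Ċ_t^{ij} E_{C_t}[∂_i∂_j e^{−V₀}(φ+ζ)] / E_{C_t}[e^{−V₀(φ+ζ)}]`
([BBD] proof of Prop 7: «`∂_t V_t = −∂_t Z_t / Z_t = −Δ_{Ċ_t}Z_t/(2Z_t)`», from Prop 5 for `Z_t`).
[cite: BauerschmidtBodineauDagallier2023, Proposition 7 (proof)] -/
theorem hasDerivAt_renormPotential_heat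
    (hG1 : ∀ x, HasFDerivAt (fun x => Real.exp (-V₀ x)) (D1 x) x)
    (hG2 : ∀ x, HasFDerivAt D1 (D2 x) x) {b : ℝ} (hb : ∀ φ, b ≤ V₀ φ)
    {M : ℝ} (hM : ∀ x, ‖D2 x‖ ≤ M) (hUC : UniformContinuous D2)
    {t : ℝ} (ht : 0 < t) (φ : EuclideanSpace ℝ (Fin N)) :
    HasDerivAt (fun s => renormPotential D V₀ s φ)
      (-((1 / 2) * ∑ i, ∑ j, D.Cdot t i j *
          ∫ x, D2 (φ + x) (EuclideanSpace.single i 1) (EuclideanSpace.single j 1)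
            ∂(multivariateGaussian 0 (D.C t))) /
        ∫ ζ, Real.exp (-V₀ (φ + ζ)) ∂(multivariateGaussian 0 (D.C t))) t := by
  have hV : Measurable V₀ := measurable_of_hasFDerivAt_exp_neg hG1
  have hGb : ∀ x, |Real.exp (-V₀ x)| ≤ Real.exp (-b) := fun x => by
    rw [← Real.norm_eq_abs]; exact norm_exp_neg_le hb x
  have hZt := hasDerivAt_integral_gaussian D hG1 hG2 hGb hM hUC ht φ
  have hne : (∫ ζ, Real.exp (-V₀ (φ + ζ)) ∂(multivariateGaussian 0 (D.C t))) ≠ 0 :=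
    (integral_exp_neg_pos hV hb _ φ).ne'
  have h := (hZt.log hne).neg
  rw [neg_div]
  exact h

/-- Evaluation of the integrated Hessian: `(E_{C_t}[D²e^{−V₀}(φ+ζ)]) u w = E_{C_t}[D²e^{−V₀}(φ+ζ)(u,w)]`.
(Proved through uniqueness of Fréchet derivatives of `ψ ↦ E[∇e^{−V₀}(ψ+ζ)] w`, which avoids
integrability bookkeeping for operator-valued integrands.) [folklore] -/
private theorem integral_D2_apply (hG2 : ∀ x, HasFDerivAt D1 (D2 x) x) {K1 : ℝ}
    (hK1 : ∀ x, ‖D1 x‖ ≤ K1) {M : ℝ} (hM : ∀ x, ‖D2 x‖ ≤ M) (hD2c : Continuous D2)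
    (P : Measure (EuclideanSpace ℝ (Fin N))) [IsProbabilityMeasure P]
    (φ u w : EuclideanSpace ℝ (Fin N)) :
    (∫ ζ, D2 (φ + ζ) ∂P) u w = ∫ ζ, D2 (φ + ζ) u w ∂P := by
  have hD1c : Continuous D1 := continuous_iff_continuousAt.2 fun x => (hG2 x).continuousAt
  set ev := ContinuousLinearMap.apply ℝ ℝ w with hev
  -- derivative of `ψ ↦ ∫ D1(ψ+ζ)` (operator valued) composed with evaluation at `w`
  have hA : HasFDerivAt (fun ψ => ev (∫ ζ, D1 (ψ + ζ) ∂P)) (ev.comp (∫ ζ, D2 (φ + ζ) ∂P)) φ :=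
    ev.hasFDerivAt.comp φ (hasFDerivAt_integral_shift hG2 hD2c hK1 hM P φ)
  -- derivative of the scalar function `ψ ↦ ∫ D1(ψ+ζ) w`
  have hB : HasFDerivAt (fun ψ => ∫ ζ, D1 (ψ + ζ) w ∂P) (∫ ζ, ev.comp (D2 (φ + ζ)) ∂P) φ := by
    refine hasFDerivAt_integral_shift (G := fun x => D1 x w) (D1 := fun x => ev.comp (D2 x))
      (fun x => ?_) (((ContinuousLinearMap.compL ℝ _ _ ℝ ev).continuous).comp hD2c)
      (K0 := K1 * ‖w‖) (fun x => ?_) (K1 := ‖ev‖ * M) (fun x => ?_) P φ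
    · have h := ev.hasFDerivAt.comp x (hG2 x)
      have hf : (fun x => D1 x w) = (⇑ev ∘ D1) := by funext y; simp [hev]
      rw [hf]
      exact h
    · calc ‖D1 x w‖ ≤ ‖D1 x‖ * ‖w‖ := ContinuousLinearMap.le_opNorm _ _
        _ ≤ K1 * ‖w‖ := mul_le_mul_of_nonneg_right (hK1 x) (norm_nonneg _)
    · calc ‖ev.comp (D2 x)‖ ≤ ‖ev‖ * ‖D2 x‖ := ContinuousLinearMap.opNorm_comp_le _ _
        _ ≤ ‖ev‖ * M := mul_le_mul_of_nonneg_left (hM x) (norm_nonneg ev)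
  -- the two functions agree
  have hI1 : ∀ ψ, Integrable (fun ζ => D1 (ψ + ζ)) P := fun ψ =>
    Integrable.of_bound (hD1c.comp (continuous_const.add continuous_id)).aestronglyMeasurable K1
      (Eventually.of_forall fun ζ => hK1 (ψ + ζ))
  have hfun : (fun ψ => ev (∫ ζ, D1 (ψ + ζ) ∂P)) = fun ψ => ∫ ζ, D1 (ψ + ζ) w ∂P := by
    funext ψ
    rw [hev, ContinuousLinearMap.apply_apply, ContinuousLinearMap.integral_apply (hI1 ψ) w]
  rw [hfun] at hA
  have huniq := hA.unique hB
  -- evaluate at `u`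
  have hI2 : Integrable (fun ζ => ev.comp (D2 (φ + ζ))) P :=
    Integrable.of_bound ((((ContinuousLinearMap.compL ℝ _ _ ℝ ev).continuous).comp hD2c).comp
      (continuous_const.add continuous_id)).aestronglyMeasurable (‖ev‖ * M)
      (Eventually.of_forall fun ζ => by
        calc ‖ev.comp (D2 (φ + ζ))‖ ≤ ‖ev‖ * ‖D2 (φ + ζ)‖ := ContinuousLinearMap.opNorm_comp_le _ _
          _ ≤ ‖ev‖ * M := mul_le_mul_of_nonneg_left (hM _) (norm_nonneg ev))
  have h := congrArg (fun L : EuclideanSpace ℝ (Fin N) →L[ℝ] ℝ => L u) huniq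
  simp only [ContinuousLinearMap.comp_apply, hev, ContinuousLinearMap.apply_apply] at h
  rw [h, ContinuousLinearMap.integral_apply hI2 u]
  simp [hev]

/-- **[BBD] Proposition 7 — the Polchinski equation.**  Let `C_t` be a covariance decomposition
(`Polchinski.CovDecomposition`, possibly degenerate positive semidefinite `Ċ_t`) and let `V₀` be
bounded below with `e^{−V₀}` twice Fréchet differentiable, `∇e^{−V₀}` bounded, `D²e^{−V₀}` bounded and
uniformly continuous.  Then for every `t > 0` and `φ ∈ ℝ^N` the renormalised potential
`V_t(φ) = −log E_{C_t}[e^{−V₀(φ+ζ)}]` satisfies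
`∂_t V_t(φ) = ½ Δ_{Ċ_t} V_t(φ) − ½ (∇V_t(φ))²_{Ċ_t}`, i.e.
`∂_t V_t(φ) = ½ Σ_{ij} Ċ_t^{ij} Hess V_t(φ)(e_i,e_j) − ½ Σ_{ij} Ċ_t^{ij} ∂_iV_t(φ) ∂_jV_t(φ)`,
where `∇V_t(φ)` and `Hess V_t(φ)` are the Fréchet derivatives certified by
`hasFDerivAt_renormPotential` / `hasFDerivAt_fderiv_renormPotential` («`∂_t V_t = −∂_tZ_t/Z_t =
−½ e^{V_t}Δ_{Ċ_t}e^{−V_t} = ½Δ_{Ċ_t}V_t − ½(∇V_t)²_{Ċ_t}`», [BBD] p0014 L64–70; BB21 Prop 1).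
Hypotheses beyond the printed «`V₀ ∈ C²`» are the boundedness/uniform-continuity ones of
`hasDerivAt_integral_gaussian`. [cite: BauerschmidtBodineauDagallier2023, Proposition 7] -/
theorem hasDerivAt_renormPotential
    (hG1 : ∀ x, HasFDerivAt (fun x => Real.exp (-V₀ x)) (D1 x) x)
    (hG2 : ∀ x, HasFDerivAt D1 (D2 x) x) {b : ℝ} (hb : ∀ φ, b ≤ V₀ φ)
    {K1 : ℝ} (hK1 : ∀ x, ‖D1 x‖ ≤ K1) {M : ℝ} (hM : ∀ x, ‖D2 x‖ ≤ M) (hUC : UniformContinuous D2)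
    {t : ℝ} (ht : 0 < t) (φ : EuclideanSpace ℝ (Fin N)) :
    HasDerivAt (fun s => renormPotential D V₀ s φ)
      ((1 / 2) * ∑ i, ∑ j, D.Cdot t i j *
          (-((∫ ζ, Real.exp (-V₀ (φ + ζ)) ∂(multivariateGaussian 0 (D.C t)))⁻¹ • (∫ ζ, D2 (φ + ζ) ∂(multivariateGaussian 0 (D.C t))) +
            ((-((∫ ζ, Real.exp (-V₀ (φ + ζ)) ∂(multivariateGaussian 0 (D.C t))) ^ 2)⁻¹) • (∫ ζ, D1 (φ + ζ) ∂(multivariateGaussian 0 (D.C t)))).smulRight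
              (∫ ζ, D1 (φ + ζ) ∂(multivariateGaussian 0 (D.C t)))))
            (EuclideanSpace.single i 1) (EuclideanSpace.single j 1) -
        (1 / 2) * ∑ i, ∑ j, D.Cdot t i j *
          ((-((∫ ζ, Real.exp (-V₀ (φ + ζ)) ∂(multivariateGaussian 0 (D.C t)))⁻¹ • (∫ ζ, D1 (φ + ζ) ∂(multivariateGaussian 0 (D.C t))))) (EuclideanSpace.single i 1) *
            (-((∫ ζ, Real.exp (-V₀ (φ + ζ)) ∂(multivariateGaussian 0 (D.C t)))⁻¹ • (∫ ζ, D1 (φ + ζ) ∂(multivariateGaussian 0 (D.C t))))) (EuclideanSpace.single j 1))) t := by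
  have hD2c : Continuous D2 := hUC.continuous
  have hV : Measurable V₀ := measurable_of_hasFDerivAt_exp_neg hG1
  set Z : ℝ := ∫ ζ, Real.exp (-V₀ (φ + ζ)) ∂(multivariateGaussian 0 (D.C t)) with hZdef
  set gZ : EuclideanSpace ℝ (Fin N) →L[ℝ] ℝ := ∫ ζ, D1 (φ + ζ) ∂(multivariateGaussian 0 (D.C t))
    with hgZdef
  set HZ : EuclideanSpace ℝ (Fin N) →L[ℝ] EuclideanSpace ℝ (Fin N) →L[ℝ] ℝ :=
    ∫ ζ, D2 (φ + ζ) ∂(multivariateGaussian 0 (D.C t)) with hHZdef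
  have hne : Z ≠ 0 := (integral_exp_neg_pos hV hb _ φ).ne'
  have h := hasDerivAt_renormPotential_heat D hG1 hG2 hb hM hUC ht φ
  refine h.congr_deriv ?_
  have hHZ : ∀ i j : Fin N, (∫ x, D2 (φ + x) (EuclideanSpace.single i 1) (EuclideanSpace.single j 1)
      ∂(multivariateGaussian 0 (D.C t))) = HZ (EuclideanSpace.single i 1) (EuclideanSpace.single j 1) :=
    fun i j => (integral_D2_apply hG2 hK1 hM hD2c _ φ _ _).symm
  have hgrad : ∀ i : Fin N, (-(Z⁻¹ • gZ)) (EuclideanSpace.single i 1) =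
      -(Z⁻¹ * gZ (EuclideanSpace.single i 1)) := fun i => by
    simp only [_root_.neg_apply, _root_.smul_apply, smul_eq_mul]
  have hhess : ∀ i j : Fin N,
      (-(Z⁻¹ • HZ + ((-(Z ^ 2)⁻¹) • gZ).smulRight gZ)) (EuclideanSpace.single i 1)
        (EuclideanSpace.single j 1) =
      -(Z⁻¹ * HZ (EuclideanSpace.single i 1) (EuclideanSpace.single j 1) +
        (-(Z ^ 2)⁻¹ * gZ (EuclideanSpace.single i 1)) * gZ (EuclideanSpace.single j 1)) :=
    fun i j => by
    simp only [_root_.neg_apply, _root_.add_apply, _root_.smul_apply, smul_eq_mul,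
      ContinuousLinearMap.smulRight_apply]
  rw [← hZdef]
  simp_rw [hHZ, hgrad, hhess]
  have hS1 : ∑ i, ∑ j, D.Cdot t i j *
      -(Z⁻¹ * HZ (EuclideanSpace.single i 1) (EuclideanSpace.single j 1) +
        -(Z ^ 2)⁻¹ * gZ (EuclideanSpace.single i 1) * gZ (EuclideanSpace.single j 1)) =
      (-Z⁻¹) * (∑ i, ∑ j, D.Cdot t i j * HZ (EuclideanSpace.single i 1) (EuclideanSpace.single j 1)) +
      (Z ^ 2)⁻¹ * (∑ i, ∑ j, D.Cdot t i j *
        (gZ (EuclideanSpace.single i 1) * gZ (EuclideanSpace.single j 1))) := by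
    rw [Finset.mul_sum, Finset.mul_sum, ← Finset.sum_add_distrib]
    refine Finset.sum_congr rfl fun i _ => ?_
    rw [Finset.mul_sum, Finset.mul_sum, ← Finset.sum_add_distrib]
    refine Finset.sum_congr rfl fun j _ => ?_
    ring
  have hS2 : ∑ i, ∑ j, D.Cdot t i j *
      (-(Z⁻¹ * gZ (EuclideanSpace.single i 1)) * -(Z⁻¹ * gZ (EuclideanSpace.single j 1))) =
      (Z ^ 2)⁻¹ * (∑ i, ∑ j, D.Cdot t i j *
        (gZ (EuclideanSpace.single i 1) * gZ (EuclideanSpace.single j 1))) := by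
    rw [Finset.mul_sum]
    refine Finset.sum_congr rfl fun i _ => ?_
    rw [Finset.mul_sum]
    refine Finset.sum_congr rfl fun j _ => ?_
    ring
  rw [hS1, hS2]
  ring

end PolchinskiEq

end Polchinski

end Literature.Analysis.FunctionSpaces

end
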